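import Summits.RiemannHypothesis.RiemannHypothesis.Theorems.ScrewPolyaSignsPolyaLandauRefutationA
import HarnessLib

/-!
# The thin dipole train — part B: integrability at `σ₁ = 2`, divergence at `σ = 1/2`, and the blockwise identity

`g x^{-3}` and `h x^{-1/2}` are integrable on `(1, ∞)`; `g x^{-3/2}` is not (each left half-block gives `≥ 1/8`);
and for `re s > 2`, `s · mellinIoi h s = mellinIoi g s` by the fundamental theorem of calculus on each block
(`x · h' = g`, `h = 0` at the block ends — no boundary terms), summed over the disjoint blocks.
Part of the refutation of `ScrewPolyaSigns.PolyaLandau` (stmt-RiemannHypothesis-24181; memo POLYA-DIPOLE-NOTE.md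
a4474ad9b7ab5cd8, rh-idea-3 g4; critic idea-crit-1 / referee ref g11 reads; RULINGs #419/#424, lane K-1, rh-split typer-4 g0).
RH-free real analysis, standard axioms; NEGATIVE KNOWLEDGE; nothing here bears on the truth of RH.
-/

-- D-0017: `Summit.RiemannHypothesis.RiemannHypothesis.…` duplicates the namespace BY DESIGN (single-problem summit).
set_option linter.dupNamespace false

noncomputable section

open Set Filter MeasureTheory Complex
open Literature.NumberTheory.LFunctions

namespace Summit.RiemannHypothesis.RiemannHypothesis.Theorems.ScrewPolyaSignsRefutation

/-! ### Integrability of `g x^{-3}` and `h x^{-1/2}`; non-integrability of `g x^{-3/2}` -/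

/-- `g · x^{-(2+1)}` is integrable on `(1, ∞)` (the hypothesis at `σ₁ = 2`). -/
theorem integrable_g : IntegrableOn (fun x : ℝ ↦ g x * x ^ (-((2 : ℝ) + 1))) (Ioi 1) := by
  refine integrableOn_of_blocks (g_measurable.mul (measurable_id.pow_const _)) (fun _ ↦ Real.exp 1)
    (fun n x hx ↦ ?_) ?_ (fun x hx hxU ↦ by rw [(g_h_zero_off hx hxU).1, zero_mul])
  · -- |g x| x^{-3} ≤ e^{3k} (lo k)^{-3} = e^{3δ} ≤ e
    have hk := one_le_kk n
    have hx0 : 0 < x := (lo_pos _).trans_le hx.1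
    have hgabs : |g x| = Real.exp (3 * (kk n : ℝ)) := by
      rcases lt_or_ge x (mid (kk n)) with hlt | hge
      · rw [g_left hk hx.1 hlt, abs_of_pos (Real.exp_pos _)]
      · rw [g_right hk hge hx.2, abs_neg, abs_of_pos (Real.exp_pos _)]
    have hpow : x ^ (-((2 : ℝ) + 1)) ≤ lo (kk n) ^ (-((2 : ℝ) + 1)) :=
      Real.rpow_le_rpow_of_nonpos (lo_pos _) hx.1 (by norm_num)
    have hlo3 : lo (kk n) ^ (-((2 : ℝ) + 1)) = Real.exp (-3 * ((kk n : ℝ) - δ (kk n))) := by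
      rw [lo, ← Real.exp_mul]; ring_nf
    have hδ := δ_le (show (0 : ℝ) ≤ kk n by unfold kk; exact_mod_cast (by omega : (0 : ℤ) ≤ n + 1))
    rw [abs_mul, hgabs, abs_of_pos (Real.rpow_pos_of_pos hx0 _)]
    calc Real.exp (3 * (kk n : ℝ)) * x ^ (-((2 : ℝ) + 1))
        ≤ Real.exp (3 * (kk n : ℝ)) * lo (kk n) ^ (-((2 : ℝ) + 1)) :=
          mul_le_mul_of_nonneg_left hpow (Real.exp_pos _).le
      _ = Real.exp (3 * δ (kk n)) := by rw [hlo3, ← Real.exp_add]; ring_nf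
      _ ≤ Real.exp 1 := Real.exp_le_exp.mpr (by linarith)
  · refine (summable_exp_lin (a := -1) 0 (by norm_num)).congr fun n ↦ ?_
    rw [← Real.exp_add]; unfold kk; push_cast; ring_nf

/-- `h · x^{-(-1/2+1)}` is integrable on `(1, ∞)` (so `mellinIoi h` is holomorphic on `re s > -1/2`). -/
theorem integrable_h : IntegrableOn (fun x : ℝ ↦ h x * x ^ (-((-1 / 2 : ℝ) + 1))) (Ioi 1) := by
  refine integrableOn_of_blocks (h_measurable.mul (measurable_id.pow_const _))
    (fun n ↦ Real.exp ((kk n : ℝ) / 2 + 1 / 8) / 4)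
    (fun n x hx ↦ ?_) ?_ (fun x hx hxU ↦ by rw [(g_h_zero_off hx hxU).2, zero_mul])
  · have hk := one_le_kk n
    have hx0 : 0 < x := (lo_pos _).trans_le hx.1
    have hk0 : (0 : ℝ) ≤ kk n := by unfold kk; exact_mod_cast (by omega : (0 : ℤ) ≤ n + 1)
    have hδ := δ_le hk0
    have hδ0 := δ_pos (kk n : ℝ)
    have hhx : |h x| ≤ Real.exp (3 * (kk n : ℝ)) * δ (kk n) := by
      rw [h_eq hk hx.1 hx.2.le, abs_of_nonneg (mul_nonneg (Real.exp_pos _).le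
        (by linarith [abs_log_sub_le hx.1 hx.2.le]))]
      exact mul_le_mul_of_nonneg_left (by linarith [abs_nonneg (Real.log x - kk n)]) (Real.exp_pos _).le
    have hpow : x ^ (-((-1 / 2 : ℝ) + 1)) ≤ lo (kk n) ^ (-((-1 / 2 : ℝ) + 1)) :=
      Real.rpow_le_rpow_of_nonpos (lo_pos _) hx.1 (by norm_num)
    have hlo3 : lo (kk n) ^ (-((-1 / 2 : ℝ) + 1)) = Real.exp (-(((kk n : ℝ) - δ (kk n)) / 2)) := by
      rw [lo, ← Real.exp_mul]; ring_nf
    rw [abs_mul, abs_of_pos (Real.rpow_pos_of_pos hx0 _)]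
    have hprod : Real.exp (3 * (kk n : ℝ)) * δ (kk n) * lo (kk n) ^ (-((-1 / 2 : ℝ) + 1))
        ≤ Real.exp ((kk n : ℝ) / 2 + 1 / 8) / 4 := by
      rw [hlo3, show δ (kk n : ℝ) = Real.exp (-2 * (kk n : ℝ)) / 4 from rfl]
      calc Real.exp (3 * (kk n : ℝ)) * (Real.exp (-2 * (kk n : ℝ)) / 4) *
            Real.exp (-(((kk n : ℝ) - δ (kk n)) / 2))
          = Real.exp (3 * (kk n : ℝ) + -2 * (kk n : ℝ) + -(((kk n : ℝ) - δ (kk n)) / 2)) / 4 := by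
            rw [Real.exp_add, Real.exp_add]; ring
        _ ≤ Real.exp ((kk n : ℝ) / 2 + 1 / 8) / 4 :=
            div_le_div_of_nonneg_right (Real.exp_le_exp.mpr (by linarith)) (by norm_num)
    calc |h x| * x ^ (-((-1 / 2 : ℝ) + 1))
        ≤ (Real.exp (3 * (kk n : ℝ)) * δ (kk n)) * lo (kk n) ^ (-((-1 / 2 : ℝ) + 1)) :=
          mul_le_mul hhx hpow (Real.rpow_pos_of_pos hx0 _).le (by positivity)
      _ ≤ Real.exp ((kk n : ℝ) / 2 + 1 / 8) / 4 := hprod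
  · refine ((summable_exp_lin (a := -1 / 2) (-3 / 8) (by norm_num)).div_const 4).congr fun n ↦ ?_
    rw [show Real.exp ((kk n : ℝ) / 2 + 1 / 8) / 4 * Real.exp (-(kk n : ℝ))
        = Real.exp ((kk n : ℝ) / 2 + 1 / 8 + -(kk n : ℝ)) / 4 by
          rw [Real.exp_add ((kk n : ℝ) / 2 + 1 / 8) (-(kk n : ℝ))]; ring]
    congr 2
    unfold kk; push_cast; ring

/-- **The conclusion fails at `σ = 1/2`:** `g · x^{-(1/2+1)}` is NOT integrable on `(1, ∞)`
(each left half-block contributes at least `1/8` to `∫ |g| x^{-3/2}`). -/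
theorem not_integrable_g_half : ¬ IntegrableOn (fun x : ℝ ↦ g x * x ^ (-((1 / 2 : ℝ) + 1))) (Ioi 1) := by
  intro hint
  set f : ℝ → ℝ := fun x ↦ g x * x ^ (-((1 / 2 : ℝ) + 1)) with hf
  set L : ℕ → Set ℝ := fun n ↦ Ico (lo (kk n)) (mid (kk n)) with hL
  have hLsub : ∀ n, L n ⊆ Ioi 1 := fun n x hx ↦
    (one_lt_lo (by unfold kk; exact_mod_cast (by omega : (1 : ℤ) ≤ n + 1))).trans_le hx.1
  have hvol : ∀ n, volume (L n) ≠ ⊤ := fun n ↦ by rw [hL, Real.volume_Ico]; exact ENNReal.ofReal_ne_top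
  -- lower bound on each left half-block
  have hblock : ∀ n : ℕ, (1 / 8 : ℝ) ≤ ∫ x in L n, ‖f x‖ := by
    intro n
    have hk := one_le_kk n
    have hk0 : (0 : ℝ) ≤ kk n := by unfold kk; exact_mod_cast (by omega : (0 : ℤ) ≤ n + 1)
    set k : ℝ := (kk n : ℝ) with hkdef
    set c : ℝ := Real.exp (3 * k) * (mid k) ^ (-((1 / 2 : ℝ) + 1)) with hc
    have hδ := δ_le hk0
    have hδ0 := δ_pos k
    have hcf : ∀ x ∈ L n, c ≤ ‖f x‖ := by
      intro x hx
      have hx0 : 0 < x := (lo_pos _).trans_le hx.1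
      rw [hf, Real.norm_eq_abs, abs_mul, g_left hk hx.1 hx.2, abs_of_pos (Real.exp_pos _),
        abs_of_pos (Real.rpow_pos_of_pos hx0 _)]
      exact mul_le_mul_of_nonneg_left
        (Real.rpow_le_rpow_of_nonpos hx0 hx.2.le (by norm_num)) (Real.exp_pos _).le
    have h1 := setIntegral_ge_of_const_le_real measurableSet_Ico (hvol n) hcf
      ((hint.mono_set (hLsub n)).norm)
    -- c · (mid - lo) ≥ 1/8
    have hlen : Real.exp k * (δ k / 2) ≤ volume.real (L n) := by
      rw [hL, Real.volume_real_Ico_of_le (lo_lt_mid _).le, mid, lo]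
      have e1 : Real.exp (k - δ k) = Real.exp k * Real.exp (-δ k) := by
        rw [sub_eq_add_neg, Real.exp_add]
      have h3 : Real.exp (-δ k) ≤ 1 / (1 + δ k) := by
        rw [le_div_iff₀ (by linarith)]
        have := Real.add_one_le_exp (δ k)
        have h4 : Real.exp (-δ k) * Real.exp (δ k) = 1 := by rw [← Real.exp_add]; simp
        nlinarith [Real.exp_pos (-δ k)]
      have h5 : δ k / 2 ≤ 1 - 1 / (1 + δ k) := by
        rw [show 1 - 1 / (1 + δ k) = δ k / (1 + δ k) by field_simp; ring]
        exact div_le_div_of_nonneg_left hδ0.le (by linarith) (by linarith)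
      rw [e1]
      nlinarith [Real.exp_pos k]
    have hcpos : 0 < c := mul_pos (Real.exp_pos _) (Real.rpow_pos_of_pos (Real.exp_pos _) _)
    have hmain : (1 / 8 : ℝ) ≤ c * (Real.exp k * (δ k / 2)) := by
      rw [hc, mid, ← Real.exp_mul, show δ k = Real.exp (-2 * k) / 4 from rfl]
      have e : Real.exp (3 * k) * Real.exp (k * -((1 / 2 : ℝ) + 1)) * (Real.exp k * (Real.exp (-2 * k) / 4 / 2))
          = Real.exp (k / 2) / 8 := by
        rw [← Real.exp_add, show Real.exp k * (Real.exp (-2 * k) / 4 / 2) = Real.exp (k + -2 * k) / 8 by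
          rw [Real.exp_add]; ring, mul_div_assoc', ← Real.exp_add]
        ring_nf
      rw [e]
      have : 1 ≤ Real.exp (k / 2) := Real.one_le_exp (by positivity)
      linarith
    calc (1 / 8 : ℝ) ≤ c * (Real.exp k * (δ k / 2)) := hmain
      _ ≤ c * volume.real (L n) := mul_le_mul_of_nonneg_left hlen hcpos.le
      _ ≤ ∫ x in L n, ‖f x‖ := h1
  -- disjointness of the left half-blocks
  have hLdisj : ∀ (N : Finset ℕ), Set.Pairwise (↑N) (Function.onFun Disjoint L) := by
    intro N m _ n _ hmn
    have := B_disjoint hmn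
    exact this.mono (fun x (hx : x ∈ L m) ↦ (⟨hx.1, hx.2.trans (mid_lt_hi _)⟩ : x ∈ B m))
      (fun x (hx : x ∈ L n) ↦ (⟨hx.1, hx.2.trans (mid_lt_hi _)⟩ : x ∈ B n))
  have hle : ∀ N : ℕ, (N : ℝ) / 8 ≤ ∫ x in Ioi 1, ‖f x‖ := by
    intro N
    calc (N : ℝ) / 8 = ∑ n ∈ Finset.range N, (1 / 8 : ℝ) := by simp [div_eq_mul_inv]
      _ ≤ ∑ n ∈ Finset.range N, ∫ x in L n, ‖f x‖ := Finset.sum_le_sum fun n _ ↦ hblock n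
      _ = ∫ x in ⋃ n ∈ Finset.range N, L n, ‖f x‖ :=
          (integral_biUnion_finset _ (fun n _ ↦ measurableSet_Ico) (hLdisj _)
            (fun n _ ↦ (hint.mono_set (hLsub n)).norm)).symm
      _ ≤ ∫ x in Ioi 1, ‖f x‖ :=
          setIntegral_mono_set hint.norm (Eventually.of_forall fun x ↦ norm_nonneg _)
            (Eventually.of_forall (iUnion₂_subset fun n _ ↦ hLsub n))
  obtain ⟨N, hN⟩ := exists_nat_gt (8 * ∫ x in Ioi 1, ‖f x‖)
  have := hle N
  linarith

/-! ### The continuation: `Φ(s) = s · mellinIoi h s`, and `Φ = mellinIoi g` on `re s > 2` -/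

/-- The complex integrand `g(x) x^{-(s+1)}` is integrable on `(1, ∞)` for `re s > 2`. -/
theorem integrable_f1 {s : ℂ} (hs : 2 < s.re) :
    IntegrableOn (fun x : ℝ ↦ (g x : ℂ) * (x : ℂ) ^ (-(s + 1))) (Ioi 1) := by
  have := Landau.integrable_mellinIntegrand g_measurable integrable_g 0 hs
  refine this.congr (Eventually.of_forall fun x ↦ ?_)
  simp [Landau.mellinIntegrand]

/-- The complex integrand `h(x) x^{-(s+1)}` is integrable on `(1, ∞)` for `re s > -1/2`. -/
theorem integrable_f2 {s : ℂ} (hs : -1 / 2 < s.re) :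
    IntegrableOn (fun x : ℝ ↦ (h x : ℂ) * (x : ℂ) ^ (-(s + 1))) (Ioi 1) := by
  have := Landau.integrable_mellinIntegrand h_measurable integrable_h 0 hs
  refine this.congr (Eventually.of_forall fun x ↦ ?_)
  simp [Landau.mellinIntegrand]

/-- Interval integrals agree when the integrands agree on the open interval. -/
theorem intervalIntegral_congr_Ioo {F G : ℝ → ℂ} {a b : ℝ} (hab : a ≤ b) (hFG : EqOn F G (Ioo a b)) :
    ∫ x in a..b, F x = ∫ x in a..b, G x := by
  rw [intervalIntegral.integral_of_le hab, intervalIntegral.integral_of_le hab,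
    integral_Ioc_eq_integral_Ioo, integral_Ioc_eq_integral_Ioo]
  exact setIntegral_congr_fun measurableSet_Ioo hFG

/-- Power algebra: `x^{-(s+1)} = x⁻¹ · x^{-s}` for real `x > 0`. -/
theorem cpow_neg_add_one {x : ℝ} (hx : 0 < x) (s : ℂ) :
    (x : ℂ) ^ (-(s + 1)) = (x : ℂ)⁻¹ * (x : ℂ) ^ (-s) := by
  rw [show -(s + 1) = -s + (-1) by ring, Complex.cpow_add _ _ (ofReal_ne_zero.mpr hx.ne'),
    Complex.cpow_neg_one]
  ring

/-- **FTC on one affine piece**: for `u(x) = H (c + ε log x) x^{-s}` (`ε = ±1`),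
`∫_a^b [H ε - s H (c + ε log x)] x^{-(s+1)} dx = u b - u a` (`0 < a ≤ b`, `s ≠ 0`). -/
theorem ftc_piece {a b : ℝ} (ha : 0 < a) (hab : a ≤ b) (H c ε : ℝ) {s : ℂ} (hs : s ≠ 0) :
    ∫ x in a..b, ((H * ε : ℝ) - s * ((H * (c + ε * Real.log x) : ℝ) : ℂ)) * (x : ℂ) ^ (-(s + 1)) =
      ((H * (c + ε * Real.log b) : ℝ) : ℂ) * (b : ℂ) ^ (-s) -
        ((H * (c + ε * Real.log a) : ℝ) : ℂ) * (a : ℂ) ^ (-s) := by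
  set u : ℝ → ℂ := fun x ↦ ((H * (c + ε * Real.log x) : ℝ) : ℂ) * (x : ℂ) ^ (-s) with hu
  have hderiv : ∀ x ∈ uIcc a b, HasDerivAt u
      (((H * ε : ℝ) - s * ((H * (c + ε * Real.log x) : ℝ) : ℂ)) * (x : ℂ) ^ (-(s + 1))) x := by
    intro x hx
    rw [uIcc_of_le hab] at hx
    have hx0 : 0 < x := ha.trans_le hx.1
    have hl : HasDerivAt (fun y : ℝ ↦ ((H * (c + ε * Real.log y) : ℝ) : ℂ))
        (((H * (ε * x⁻¹)) : ℝ) : ℂ) x := by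
      have := (((Real.hasDerivAt_log hx0.ne').const_mul ε).const_add c).const_mul H
      exact this.ofReal_comp
    have hp : HasDerivAt (fun y : ℝ ↦ (y : ℂ) ^ (-s)) (-s * (x : ℂ) ^ (-s - 1)) x :=
      hasDerivAt_ofReal_cpow_const hx0.ne' (neg_ne_zero.mpr hs)
    refine (hl.mul hp).congr_deriv ?_
    rw [show (-s - 1 : ℂ) = -(s + 1) by ring, cpow_neg_add_one hx0]
    push_cast
    ring
  have hcont : ContinuousOn
      (fun x : ℝ ↦ ((H * ε : ℝ) - s * ((H * (c + ε * Real.log x) : ℝ) : ℂ)) * (x : ℂ) ^ (-(s + 1)))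
      (uIcc a b) := by
    intro x hx
    rw [uIcc_of_le hab] at hx
    have hx0 : 0 < x := ha.trans_le hx.1
    refine ContinuousAt.continuousWithinAt ?_
    refine ContinuousAt.mul ?_ (continuousAt_ofReal_cpow_const x _ (Or.inr hx0.ne'))
    refine continuousAt_const.sub (continuousAt_const.mul ?_)
    exact Complex.continuous_ofReal.continuousAt.comp
      (continuousAt_const.mul (continuousAt_const.add
        (continuousAt_const.mul (Real.continuousAt_log hx0.ne'))))
  exact intervalIntegral.integral_eq_sub_of_hasDerivAt hderiv (hcont.intervalIntegrable)

/-- The integrand `F = (g - s h) x^{-(s+1)}` has zero integral over each block (`re s > 2`). -/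
theorem block_integral_zero {k : ℤ} (hk : 1 ≤ k) {s : ℂ} (hs : 2 < s.re) :
    ∫ x in Ico (lo k) (hi k),
      ((g x : ℂ) * (x : ℂ) ^ (-(s + 1)) - s * ((h x : ℂ) * (x : ℂ) ^ (-(s + 1)))) = 0 := by
  set H : ℝ := Real.exp (3 * k) with hH
  set a := lo (k : ℝ) with ha'
  set b := mid (k : ℝ) with hb'
  set c := hi (k : ℝ) with hc'
  have hab : a < b := lo_lt_mid _
  have hbc : b < c := mid_lt_hi _
  have ha0 : 0 < a := lo_pos _
  have hb0 : 0 < b := ha0.trans hab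
  have ha1 : 1 < a := one_lt_lo (by exact_mod_cast hk)
  have hs0 : s ≠ 0 := by
    intro h0; rw [h0] at hs; simp at hs; linarith
  set F : ℝ → ℂ := fun x ↦ (g x : ℂ) * (x : ℂ) ^ (-(s + 1)) - s * ((h x : ℂ) * (x : ℂ) ^ (-(s + 1)))
    with hF
  -- F is integrable on (1, ∞), hence interval integrable on the pieces
  have hFint : IntegrableOn F (Ioi 1) :=
    (integrable_f1 hs).sub ((integrable_f2 (by linarith)).const_mul s)
  have hFab : IntervalIntegrable F volume a b := by
    rw [intervalIntegrable_iff_integrableOn_Ioc_of_le hab.le]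
    exact hFint.mono_set fun x hx ↦ ha1.trans hx.1
  have hFbc : IntervalIntegrable F volume b c := by
    rw [intervalIntegrable_iff_integrableOn_Ioc_of_le hbc.le]
    exact hFint.mono_set fun x hx ↦ (ha1.trans hab).trans hx.1
  -- values of log at the block ends
  have hla : Real.log a = k - δ k := by rw [ha', lo, Real.log_exp]
  have hlb : Real.log b = k := by rw [hb', mid, Real.log_exp]
  have hlc : Real.log c = k + δ k := by rw [hc', hi, Real.log_exp]
  -- on (a, b): F = derivative of u₁, with c₁ = δ - k, ε = 1
  have hF1 : EqOn F (fun x ↦ ((H * 1 : ℝ) - s * ((H * ((δ k - k) + 1 * Real.log x) : ℝ) : ℂ)) *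
      (x : ℂ) ^ (-(s + 1))) (Ioo a b) := by
    intro x hx
    have hx0 : 0 < x := ha0.trans hx.1
    have hlogx : Real.log x < k := by
      have := Real.log_lt_log hx0 hx.2; rwa [hlb] at this
    have hgx : g x = H := g_left hk hx.1.le hx.2
    have hhx : h x = H * (δ k - k + Real.log x) := by
      rw [h_eq hk hx.1.le (hx.2.le.trans hbc.le), abs_of_neg (by linarith)]; ring
    simp only [hF, hgx, hhx]
    push_cast
    ring
  -- on (b, c): F = derivative of u₂, with c₂ = δ + k, ε = -1
  have hF2 : EqOn F (fun x ↦ ((H * (-1) : ℝ) - s * ((H * ((δ k + k) + (-1) * Real.log x) : ℝ) : ℂ)) *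
      (x : ℂ) ^ (-(s + 1))) (Ioo b c) := by
    intro x hx
    have hx0 : 0 < x := hb0.trans hx.1
    have hlogx : (k : ℝ) < Real.log x := by
      have := Real.log_lt_log hb0 hx.1; rwa [hlb] at this
    have hgx : g x = -H := g_right hk hx.1.le hx.2
    have hhx : h x = H * (δ k + k - Real.log x) := by
      rw [h_eq hk (hab.le.trans hx.1.le) hx.2.le, abs_of_pos (by linarith)]; ring
    simp only [hF, hgx, hhx]
    push_cast
    ring
  -- assemble
  have e0 : ∫ x in Ico a c, F x = ∫ x in a..c, F x := by
    rw [intervalIntegral.integral_of_le (hab.trans hbc).le, integral_Ioc_eq_integral_Ioo,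
      integral_Ico_eq_integral_Ioo]
  rw [e0, ← intervalIntegral.integral_add_adjacent_intervals hFab hFbc,
    intervalIntegral_congr_Ioo hab.le hF1, intervalIntegral_congr_Ioo hbc.le hF2,
    ftc_piece ha0 hab.le H (δ k - k) 1 hs0, ftc_piece hb0 hbc.le H (δ k + k) (-1) hs0,
    hla, hlb, hlc]
  push_cast
  ring

/-- **`s · mellinIoi h s = mellinIoi g s` for `re s > 2`** (blockwise FTC; no boundary terms). -/
theorem mellin_identity {s : ℂ} (hs : 2 < s.re) :
    s * Landau.mellinIoi h s = Landau.mellinIoi g s := by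
  set F : ℝ → ℂ := fun x ↦ (g x : ℂ) * (x : ℂ) ^ (-(s + 1)) - s * ((h x : ℂ) * (x : ℂ) ^ (-(s + 1)))
    with hF
  have hf1 := integrable_f1 hs
  have hf2 := integrable_f2 (s := s) (by linarith)
  have hFint : IntegrableOn F (Ioi 1) := hf1.sub (hf2.const_mul s)
  have hzero : ∫ x in Ioi 1, F x = 0 := by
    rw [setIntegral_eq_of_subset_of_forall_sdiff_eq_zero measurableSet_Ioi iUnion_B_subset
      (fun x hx ↦ by
        obtain ⟨hg0, hh0⟩ := g_h_zero_off hx.1 hx.2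
        simp [hF, hg0, hh0])]
    rw [integral_iUnion (s := B) (fun n ↦ measurableSet_Ico) B_disjoint (hFint.mono_set iUnion_B_subset)]
    have hb : ∀ n, ∫ x in B n, F x = 0 := fun n ↦ by
      rw [hF]; exact block_integral_zero (one_le_kk n) hs
    simp [hb]
  have e : ∫ x in Ioi 1, F x = (∫ x in Ioi 1, (g x : ℂ) * (x : ℂ) ^ (-(s + 1))) -
      s * ∫ x in Ioi 1, (h x : ℂ) * (x : ℂ) ^ (-(s + 1)) := by
    rw [hF, integral_sub hf1 (hf2.const_mul s), integral_const_mul]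
  rw [e] at hzero
  unfold Landau.mellinIoi
  linear_combination (-1 : ℂ) * hzero

end Summit.RiemannHypothesis.RiemannHypothesis.Theorems.ScrewPolyaSignsRefutation
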